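import Literature.NumberTheory.Automorphic.UnitaryGroupUnipotentBallsJacquet
import Literature.NumberTheory.Automorphic.HyperspecialUnitaryCartan
import Literature.NumberTheory.Automorphic.ValuedFieldValuativeRelBridge
import HarnessLib

/-!
# The uniform gap for `U(σ, Φ₃)(K)` and the Cartan decomposition along Rogawski's torus: `U = ⋃_{M ≥ 0} K₀ · d(ϖ^M, 1, ϖ^{-M}) · K₀`

THEOREMS ONLY (no `def`, no `instance`, no `sorry`; axioms ⊆ {propext, Classical.choice, Quot.sound}).  Notation as in ★
`UnitaryGroupUnipotentBallsJacquet`: `U = U(σ, Φ₃)(K)`, `K₀ = U ∩ GL₃(𝒪)` (written `(glInt 3 K).comap U.subtype`), `a_M = d(ϖ^M, 1, ϖ^{-M})`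
(hypotheses `(a) (ha)`), `w₀ ∈ U` the long Weyl element (★ `weylLongU`).

## Contents
* §1 (`K` a non-archimedean local field, `σ` continuous) `isCompact_comap_glInt` (`K₀` is compact) and `exists_uniform_gap` — the UNIFORM GAP:
  if `V_N = 0` (every vector lies in `ker(V → V_N)`), then for a smooth vector `v` and a smooth linear form `φ` there is `D` with
  `φ(ρ(k₁ a_M k₂) v) = 0` for all `k₁, k₂ ∈ K₀`, `M ≥ D` (the gap lemma ★ `exists_forall_apply_torus_eq_zero` applied to the finitely many
  vectors `ρ(k₂) v`, `k₂ ∈ K₀ / (K₀ ∩ Stab v)`, and forms `φ ∘ ρ(k₁)`, `k₁ ∈ K₀ / (K₀ ∩ Fix φ)`).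
* §2 (`K` with a `ℤᵐ⁰`-valued valuation compatible with its `ValuativeRel`; no topology) the CARTAN DECOMPOSITION in torus form,
  `exists_comap_glInt_mul_torus_mul`: under the unramified local conjugation datum ★ `HermitianLattice.UnramifiedLocalConjDatum σ ϖ` every
  `g ∈ U` is `k₁ · a_M · k₂` with `k₁, k₂ ∈ K₀`, `M : ℕ` — from ★ `UnramifiedLocalConjDatum.exists_cartan_antidiagonal` (`k₁ g k₂ = diag(d)`,
  `σ d = d`, `d_i d_{2-i} = 1`) by stripping the unit part `diag(u₀, d₁, u₀⁻¹) ∈ K₀` (`glDiagonal_mem_and_mem_glInt`) and flipping a negative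
  exponent with `w₀ a_M w₀ = a_M⁻¹` (`weylLongU_mul_torus_mul_weylLongU`, `weylLongU_mem_comap_glInt`); auxiliary
  `mem_glInt_of_forall_valuation_le_one` (with the `Valued`/`ValuativeRel` bridge ★ `ValuedFieldValuativeRelBridge`).

HC_CM is proved only modulo the printed citations until rung 0 closes; this file discharges nothing by itself — it feeds
★ `U3JacquetVanishingSupercuspidalUnramified`.

## References
* [Casselman1995] W. Casselman, *Introduction to the theory of admissible representations of `p`-adic reductive groups* (1995 notes),
  Prop. 1.4.4 (Jacquet's first lemma), Thm. 5.3.1 (Harish-Chandra's criterion).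
* [BernsteinZelevinsky1976] I. N. Bernstein, A. V. Zelevinsky, *Representations of the group GL(n, F) where F is a non-archimedean local
  field*, Russian Math. Surveys 31:3 (1976), §3.18–3.21, Thm. 3.21.
* [BernsteinZelevinsky1977] I. N. Bernstein, A. V. Zelevinsky, *Induced representations of reductive p-adic groups I*, Ann. Sci. ÉNS 10
  (1977), §1.8.
* [HarishChandra1970] Harish-Chandra (notes by G. van Dijk), *Harmonic analysis on reductive p-adic groups*, LNM 162 (1970), Part I §3.
* [Rogawski1990] J. D. Rogawski, *Automorphic Representations of Unitary Groups in Three Variables*, Ann. of Math. Stud. 123 (1990), §1.10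
  p. 9 (the quasi-split `U(3)`, its Borel and torus), §12.2 p. 173.
* [Tits1979] J. Tits, *Reductive groups over local fields*, Proc. Sympos. Pure Math. 33.1 (1979), §3.3.3 (Cartan decomposition).
* [BruhatTits1972] F. Bruhat, J. Tits, *Groupes réductifs sur un corps local I*, Publ. Math. IHÉS 41 (1972), (4.4.3).
* [Serre1979] J.-P. Serre, *Local Fields*, GTM 67 (1979), Ch. I §1, Ch. II §1.
* [PlatonovRapinchuk1994] V. Platonov, A. Rapinchuk, *Algebraic Groups and Number Theory* (1994), §3.3, §5.1.
* [GetzHahn2024] J. R. Getz, H. Hahn, *An Introduction to Automorphic Representations*, GTM 300 (2024), Thm. 8.3.3 (printed p. 155) (HELD).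
-/

set_option autoImplicit false

open scoped MatrixGroups Pointwise Topology WithZero
open ValuativeRel Matrix

namespace Literature.NumberTheory.Automorphic

namespace UnitaryGroup

/-! ## §1 The compact open `K₀ = U ∩ GL₃(𝒪)` and the uniform gap -/

section UniformGap

variable {K : Type*} [Field K] [ValuativeRel K] [TopologicalSpace K] [IsNonarchimedeanLocalField K]
  (σ : K →+* K) {J : Matrix (Fin 3) (Fin 3) K} (hJ : J = (StdForm.antidiagonal 3).over K) {ϖ : K} (hϖ0 : ϖ ≠ 0)
  {V : Type*} [AddCommGroup V] [Module ℂ V]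

/-- `K₀ = U ∩ GL₃(𝒪)` is compact (closed embedding `U ↪ GL₃(K)`, ★ `isCompact_glInt`). [cite: PlatonovRapinchuk1994, §3.3] -/
theorem isCompact_comap_glInt (hσc : Continuous σ) :
    IsCompact (((glInt 3 K).comap (unitaryGroupOfForm σ J).subtype : Subgroup ↥(unitaryGroupOfForm σ J)) : Set ↥(unitaryGroupOfForm σ J)) := by
  haveI : T2Space K := (Literature.NumberTheory.GaloisRepresentations.IsNonarchimedeanLocalField.isLocalField K).toT2Space
  exact (isClosed_unitaryGroupOfForm hσc J).isClosedEmbedding_subtypeVal.isCompact_preimage (isCompact_glInt 3 K)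

/-- **The uniform gap.**  If `ρ` is smooth with `V_N = 0`, then for `φ ∈ Ṽ` and `v ∈ V` there is ONE `D` with
`φ(ρ(k₁ a_M k₂) v) = 0` for all `k₁, k₂ ∈ K₀ = U ∩ GL₃(𝒪)` and all `M ≥ D`: the `K₀`-orbits of `φ` and `v` are finite (★
`JacquetLemma.finite_orbit_of_isSmoothVector`) and the gap lemma applies to each pair. [cite: Casselman1995, Thm. 5.3.1]
[cite: BernsteinZelevinsky1976, Thm. 3.21] -/
theorem exists_uniform_gap (hσc : Continuous σ) (hϖ1 : valuation K ϖ < 1) (a : ℕ → ↥(unitaryGroupOfForm σ J))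
    (ha : ∀ N, ((a N : ↥(unitaryGroupOfForm σ J)) : GL (Fin 3) K) = zpowDiagGL hϖ0 (fun i : Fin 3 => (N : ℤ) * (1 - (i.val : ℤ))))
    (ρ : Representation ℂ ↥(unitaryGroupOfForm σ J) V) (hρ : ρ.IsSmooth)
    (hker : Representation.Coinvariants.ker ((borelTriple σ J hJ).restrict ρ) = ⊤)
    {φ : Module.Dual ℂ V} (hφ : φ ∈ ρ.contragredient) (v : V) :
    ∃ D : ℕ, ∀ k₁ ∈ (glInt 3 K).comap (unitaryGroupOfForm σ J).subtype, ∀ k₂ ∈ (glInt 3 K).comap (unitaryGroupOfForm σ J).subtype,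
      ∀ M : ℕ, D ≤ M → φ (ρ (k₁ * a M * k₂) v) = 0 := by
  classical
  have hK₀c := isCompact_comap_glInt σ (J := J) hσc
  obtain ⟨Oφ, hOφ⟩ : ∃ Oφ : Set (Module.Dual ℂ V), Oφ = (fun g => ρ.dual g φ) '' ((glInt 3 K).comap (unitaryGroupOfForm σ J).subtype : Set ↥(unitaryGroupOfForm σ J)) :=
    ⟨_, rfl⟩
  obtain ⟨Ov, hOv⟩ : ∃ Ov : Set V, Ov = (fun g => ρ g v) '' ((glInt 3 K).comap (unitaryGroupOfForm σ J).subtype : Set ↥(unitaryGroupOfForm σ J)) := ⟨_, rfl⟩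
  have hOφfin : Oφ.Finite := by
    rw [hOφ]; exact JacquetLemma.finite_orbit_of_isSmoothVector ρ.dual _ hK₀c subset_rfl hφ
  have hOvfin : Ov.Finite := by
    rw [hOv]; exact JacquetLemma.finite_orbit_of_isSmoothVector ρ _ hK₀c subset_rfl (hρ v)
  -- pointwise gaps
  have hgap : ∀ φ' ∈ Oφ, ∀ v' : V, ∃ d : ℕ, ∀ M : ℕ, d ≤ M → φ' (ρ (a M) v') = 0 := by
    intro φ' hφ' v'
    rw [hOφ] at hφ'
    obtain ⟨g, -, rfl⟩ := hφ'
    refine exists_forall_apply_torus_eq_zero σ hJ hϖ0 hσc hϖ1 a ha ρ hρ (ρ.contragredient.apply_mem_toSubmodule g hφ) ?_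
    rw [hker]
    trivial
  let dfun : Module.Dual ℂ V → V → ℕ := fun φ' v' => if h : φ' ∈ Oφ then Classical.choose (hgap φ' h v') else 0
  have hdfun : ∀ φ', φ' ∈ Oφ → ∀ (v' : V) (M : ℕ), dfun φ' v' ≤ M → φ' (ρ (a M) v') = 0 := by
    intro φ' h₁ v' M hM
    have hM' : Classical.choose (hgap φ' h₁ v') ≤ M := by simpa only [dfun, dif_pos h₁] using hM
    exact Classical.choose_spec (hgap φ' h₁ v') M hM'
  obtain ⟨D, hD⟩ : ∃ D : ℕ, ∀ φ' ∈ Oφ, ∀ v' ∈ Ov, dfun φ' v' ≤ D := by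
    have hfin : ((fun x : Module.Dual ℂ V × V => dfun x.1 x.2) '' (Oφ ×ˢ Ov)).Finite := (hOφfin.prod hOvfin).image _
    obtain ⟨D, hD⟩ := hfin.bddAbove
    exact ⟨D, fun φ' hφ' v' hv' => hD ⟨(φ', v'), ⟨hφ', hv'⟩, rfl⟩⟩
  refine ⟨D, fun k₁ hk₁ k₂ hk₂ M hM => ?_⟩
  have h1 : φ (ρ (k₁ * a M * k₂) v) = (ρ.dual k₁⁻¹ φ) (ρ (a M) (ρ k₂ v)) := by
    rw [Representation.dual_apply, inv_inv, Module.Dual.transpose_apply, LinearMap.comp_apply,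
      ← Module.End.mul_apply, ← MonoidHom.map_mul, ← Module.End.mul_apply, ← MonoidHom.map_mul]
  rw [h1]
  have hφ' : ρ.dual k₁⁻¹ φ ∈ Oφ := by rw [hOφ]; exact ⟨k₁⁻¹, Subgroup.inv_mem _ hk₁, rfl⟩
  have hv' : ρ k₂ v ∈ Ov := by rw [hOv]; exact ⟨k₂, hk₂, rfl⟩
  exact hdfun _ hφ' _ M (le_trans (hD _ hφ' _ hv') hM)


end UniformGap

/-! ## §2 The Cartan decomposition of `U(σ, Φ₃)(K)` along Rogawski's torus: `g = k₁ · a_M · k₂`, `k₁, k₂ ∈ K₀`, `M ≥ 0` -/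

section CartanForm

variable {K : Type*} [Field K] [Valued K ℤᵐ⁰] [ValuativeRel K] [(Valued.v : Valuation K ℤᵐ⁰).Compatible]
  (σ : K →+* K) {J : Matrix (Fin 3) (Fin 3) K} (hJ : J = (StdForm.antidiagonal 3).over K) {ϖ : K} (hϖ0 : ϖ ≠ 0)

omit [ValuativeRel K] [(Valued.v : Valuation K ℤᵐ⁰).Compatible] in
/-- Every non-zero `x` has `v x = exp(e)` for some `e ∈ ℤ` (private copy of ★ `HermitianLattice.exists_v_eq_exp`). [cite: Serre1979, Ch. I §1] -/
private theorem exists_v_eq_exp' {x : K} (hx : x ≠ 0) : ∃ e : ℤ, Valued.v x = WithZero.exp e :=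
  ⟨_, (WithZero.exp_log ((Valuation.ne_zero_iff _).2 hx)).symm⟩

omit [ValuativeRel K] [(Valued.v : Valuation K ℤᵐ⁰).Compatible] in
/-- `v (x · ϖ^e) = 1` when `v x = exp(e)` and `v ϖ = exp(-1)` (private copy of ★ `HermitianLattice.v_mul_zpow_eq_one_of_v_eq_exp`).
[cite: Serre1979, Ch. I §1] -/
private theorem v_mul_zpow_eq_one' (hϖ : Valued.v ϖ = WithZero.exp (-1 : ℤ)) {x : K} {e : ℤ}
    (he : Valued.v x = WithZero.exp e) : Valued.v (x * ϖ ^ e) = 1 := by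
  rw [map_mul, map_zpow₀, he, hϖ, ← WithZero.exp_zsmul, smul_eq_mul, mul_neg, mul_one, ← WithZero.exp_add,
    add_neg_cancel, WithZero.exp_zero]

omit [Valued K ℤᵐ⁰] [(Valued.v : Valuation K ℤᵐ⁰).Compatible] in
/-- A matrix whose entries and whose inverse's entries have `valuation ≤ 1` lies in `GL₃(𝒪)` (★ `mem_glInt_iff`). [cite: Serre1979, Ch. II §1] -/
theorem mem_glInt_of_forall_valuation_le_one {n : ℕ} {k : GL (Fin n) K}
    (hk : ∀ i j, valuation K ((k : Matrix (Fin n) (Fin n) K) i j) ≤ 1)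
    (hk' : ∀ i j, valuation K (((k⁻¹ : GL (Fin n) K) : Matrix (Fin n) (Fin n) K) i j) ≤ 1) : k ∈ glInt n K :=
  (mem_glInt_iff k).2 ⟨fun i j => (Valuation.mem_integer_iff _ _).2 (hk i j), fun i j => (Valuation.mem_integer_iff _ _).2 (hk' i j)⟩

omit [Valued K ℤᵐ⁰] [ValuativeRel K] [(Valued.v : Valuation K ℤᵐ⁰).Compatible] in
/-- **`w₀ a_M w₀ = a_M⁻¹`**: conjugating Rogawski's torus element `d(ϖ^M, 1, ϖ^{-M})` by the long Weyl element `w₀ ∈ U(σ, Φ₃)` (★ `weylLongU`)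
inverts it (`w₀ diag(x₀,x₁,x₂) w₀ = diag(x₂,x₁,x₀)`). [cite: Rogawski1990, §1.10 p. 9] -/
theorem weylLongU_mul_torus_mul_weylLongU (a : ℕ → ↥(unitaryGroupOfForm σ J))
    (ha : ∀ N, ((a N : ↥(unitaryGroupOfForm σ J)) : GL (Fin 3) K) = zpowDiagGL hϖ0 (fun i : Fin 3 => (N : ℤ) * (1 - (i.val : ℤ)))) (M : ℕ) :
    weylLongU σ hJ * a M * weylLongU σ hJ = (a M)⁻¹ := by
  apply Subtype.ext
  rw [Subgroup.coe_mul, Subgroup.coe_mul, Subgroup.coe_inv, coe_weylLongU, ha, ← zpowDiagGL_neg]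
  refine Units.ext (Matrix.ext fun i j => ?_)
  rw [Units.val_mul, Units.val_mul, coe_zpowDiagGL, coe_zpowDiagGL]
  have h1 : (((weylLong 3 K : GL (Fin 3) K) : Matrix (Fin 3) (Fin 3) K) * Matrix.diagonal (fun i : Fin 3 => ϖ ^ ((M : ℤ) * (1 - (i.val : ℤ)))) *
      ((weylLong 3 K : GL (Fin 3) K) : Matrix (Fin 3) (Fin 3) K)) i j =
      (Matrix.diagonal (fun i : Fin 3 => ϖ ^ ((M : ℤ) * (1 - (i.val : ℤ))))) i.rev j.rev := by
    have e1 : (((weylLong 3 K : GL (Fin 3) K) : Matrix (Fin 3) (Fin 3) K) * Matrix.diagonal (fun i : Fin 3 => ϖ ^ ((M : ℤ) * (1 - (i.val : ℤ))))) =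
        fun i j => (Matrix.diagonal (fun i : Fin 3 => ϖ ^ ((M : ℤ) * (1 - (i.val : ℤ))))) i.rev j := by
      rw [coe_weylLong, Equiv.Perm.permMatrix, PEquiv.toMatrix_toPEquiv_mul]; rfl
    have e2 : ∀ M' : Matrix (Fin 3) (Fin 3) K, M' * ((weylLong 3 K : GL (Fin 3) K) : Matrix (Fin 3) (Fin 3) K) = fun i j => M' i j.rev := by
      intro M'
      rw [coe_weylLong, Equiv.Perm.permMatrix, PEquiv.mul_toMatrix_toPEquiv]; rfl
    rw [e2, e1]
  rw [h1, Matrix.diagonal_apply, Matrix.diagonal_apply, Pi.neg_apply]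
  by_cases hij : i = j
  · subst hij
    rw [if_pos rfl, if_pos rfl]
    congr 1
    have hi := i.isLt
    have hr : ((Fin.rev i).val : ℤ) = 2 - (i.val : ℤ) := by
      have h := Fin.val_rev i
      omega
    rw [hr]; ring
  · have hij' : i.rev ≠ j.rev := fun h => hij (Fin.rev_injective h)
    rw [if_neg hij', if_neg hij]

omit [Valued K ℤᵐ⁰] [(Valued.v : Valuation K ℤᵐ⁰).Compatible] in
/-- `w₀ ∈ K₀ = U ∩ GL₃(𝒪)` (a permutation matrix: entries `0, 1`; `w₀⁻¹ = w₀`). [cite: Rogawski1990, §1.10 p. 9] -/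
theorem weylLongU_mem_comap_glInt : weylLongU σ hJ ∈ (glInt 3 K).comap (unitaryGroupOfForm σ J).subtype := by
  have hentry : ∀ i j, valuation K ((((weylLong 3 K : GL (Fin 3) K)) : Matrix (Fin 3) (Fin 3) K) i j) ≤ 1 := by
    intro i j
    rw [coe_weylLong, Equiv.Perm.permMatrix, PEquiv.toMatrix_apply]
    split_ifs
    · rw [map_one]
    · rw [map_zero]; exact zero_le
  show ((weylLongU σ hJ : ↥(unitaryGroupOfForm σ J)) : GL (Fin 3) K) ∈ glInt 3 K
  rw [coe_weylLongU]
  refine mem_glInt_of_forall_valuation_le_one hentry fun i j => ?_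
  rw [weylLong_inv]
  exact hentry i j

include hJ in
/-- **A `σ`-adapted diagonal of units lies in `K₀ ∩ U`**: for units `w₀ w₁ w₂` of valuation one with `σ(w_{rev i}) w_i = 1`, the diagonal
matrix `diag(w)` lies in `U(σ, Φ₃) ∩ GL₃(𝒪)` (★ `glDiagonal_mem_unitaryGroupOfForm_antidiagonal_iff`). [cite: Rogawski1990, §1.10 p. 9] -/
theorem glDiagonal_mem_and_mem_glInt (w : Fin 3 → Kˣ) (hw : ∀ i, σ (w (Fin.rev i) : K) * (w i : K) = 1) (hv : ∀ i, Valued.v (w i : K) = 1) :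
    glDiagonal 3 K w ∈ unitaryGroupOfForm σ J ∧ glDiagonal 3 K w ∈ glInt 3 K := by
  refine ⟨?_, ?_⟩
  · rw [hJ, glDiagonal_mem_unitaryGroupOfForm_antidiagonal_iff]; exact hw
  · refine mem_glInt_of_forall_valuation_le_one (fun i j => ?_) (fun i j => ?_)
    · rw [coe_glDiagonal, Matrix.diagonal_apply]
      split_ifs
      · exact ((v_le_one_iff_valuation_le_one _).1 (hv _).le)
      · rw [map_zero]; exact zero_le
    · rw [← map_inv, coe_glDiagonal, Matrix.diagonal_apply]
      split_ifs
      · refine (v_le_one_iff_valuation_le_one _).1 ?_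
        rw [Pi.inv_apply, Units.val_inv_eq_inv_val, map_inv₀, hv, inv_one]
      · rw [map_zero]; exact zero_le

include hJ in
/-- **THE CARTAN DECOMPOSITION OF `U(σ, Φ₃)(K)` ALONG ROGAWSKI'S TORUS.**  Under the unramified local conjugation datum (★
`HermitianLattice.UnramifiedLocalConjDatum σ ϖ`: `σ` an isometric involution, `ϖ` a `σ`-fixed uniformiser, trace∕norm surjectivity — every
unramified quadratic extension of non-archimedean local fields, the dyadic ones included) every `g ∈ U = U(σ, Φ₃)(K)` is
`k₁ · d(ϖ^M, 1, ϖ^{-M}) · k₂` with `k₁, k₂ ∈ K₀ = U ∩ GL₃(𝒪)` and `M ≥ 0`: ★ `UnramifiedLocalConjDatum.exists_cartan_antidiagonal` gives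
`k₁ g k₂ = diag(d)`, `σ d = d`, `d_i d_{2-i} = 1`; strip the valuation of `d₀` (`d₀ = u₀ ϖ^{-e}`, `|u₀| = 1`), absorb the unit diagonal
`diag(u₀, d₁, u₀⁻¹) ∈ K₀`, and flip a negative exponent with `w₀ ∈ K₀`. [cite: Tits1979, §3.3.3] [cite: BruhatTits1972, (4.4.3)]
[cite: Rogawski1990, §1.10 p. 9] -/
theorem exists_comap_glInt_mul_torus_mul (hd : HermitianLattice.UnramifiedLocalConjDatum σ ϖ) (a : ℕ → ↥(unitaryGroupOfForm σ J))
    (ha : ∀ N, ((a N : ↥(unitaryGroupOfForm σ J)) : GL (Fin 3) K) = zpowDiagGL hϖ0 (fun i : Fin 3 => (N : ℤ) * (1 - (i.val : ℤ)))) (g : ↥(unitaryGroupOfForm σ J)) :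
    ∃ k₁ ∈ (glInt 3 K).comap (unitaryGroupOfForm σ J).subtype, ∃ k₂ ∈ (glInt 3 K).comap (unitaryGroupOfForm σ J).subtype,
      ∃ M : ℕ, g = k₁ * a M * k₂ := by
  classical
  have hgU : ((g : ↥(unitaryGroupOfForm σ J)) : GL (Fin 3) K) ∈ unitaryGroupOfForm σ ((StdForm.antidiagonal 3).over K) := by
    rw [← hJ]; exact g.2
  obtain ⟨k₁, k₂, hk₁U, hk₁i, hk₁i', hk₂U, hk₂i, hk₂i', d, hdiag, hdσ, hdd⟩ := hd.exists_cartan_antidiagonal _ hgU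
  have hk₁U' : k₁ ∈ unitaryGroupOfForm σ J := by rw [hJ]; exact hk₁U
  have hk₂U' : k₂ ∈ unitaryGroupOfForm σ J := by rw [hJ]; exact hk₂U
  have hbr : ∀ {k : GL (Fin 3) K}, (∀ i j, Valued.v ((k : Matrix (Fin 3) (Fin 3) K) i j) ≤ 1) →
      (∀ i j, Valued.v (((k⁻¹ : GL (Fin 3) K) : Matrix (Fin 3) (Fin 3) K) i j) ≤ 1) → k ∈ glInt 3 K := fun hk hk' =>
    mem_glInt_of_forall_valuation_le_one (fun i j => (v_le_one_iff_valuation_le_one _).1 (hk i j))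
      (fun i j => (v_le_one_iff_valuation_le_one _).1 (hk' i j))
  have hk₁I : k₁ ∈ glInt 3 K := hbr hk₁i hk₁i'
  have hk₂I : k₂ ∈ glInt 3 K := hbr hk₂i hk₂i'
  -- the diagonal
  have hd02 : d 0 * d 2 = 1 := hdd 0
  have hd11 : d 1 * d 1 = 1 := hdd 1
  have hd0 : d 0 ≠ 0 := left_ne_zero_of_mul_eq_one hd02
  have hd1 : d 1 ≠ 0 := left_ne_zero_of_mul_eq_one hd11
  obtain ⟨e, he⟩ := exists_v_eq_exp' hd0
  have hu : Valued.v (d 0 * ϖ ^ e) = 1 := v_mul_zpow_eq_one' hd.vϖ he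
  have hu0 : d 0 * ϖ ^ e ≠ 0 := fun h => by rw [h, map_zero] at hu; exact zero_ne_one hu
  have hd1v : Valued.v (d 1) = 1 :=
    Literature.NumberTheory.QuadraticForms.OMeara65.WithZeroMulInt.eq_one_of_mul_self (by rw [← map_mul, hd11, map_one])
  have hσu : σ (d 0 * ϖ ^ e) = d 0 * ϖ ^ e := by rw [map_mul, map_zpow₀, hdσ 0, hd.σϖ]
  -- the unit diagonal `diag(u₀, d₁, u₀⁻¹)`
  obtain ⟨w, hw0, hw1, hw2⟩ : ∃ w : Fin 3 → Kˣ, (w 0 : K) = d 0 * ϖ ^ e ∧ (w 1 : K) = d 1 ∧ (w 2 : K) = (d 0 * ϖ ^ e)⁻¹ :=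
    ⟨![Units.mk0 _ hu0, Units.mk0 _ hd1, (Units.mk0 _ hu0)⁻¹], rfl, rfl, by simp⟩
  have hwσ : ∀ i, σ (w (Fin.rev i) : K) * (w i : K) = 1 := by
    intro i
    fin_cases i
    · show σ (w 2 : K) * (w 0 : K) = 1
      rw [hw2, hw0, map_inv₀, hσu, inv_mul_cancel₀ hu0]
    · show σ (w 1 : K) * (w 1 : K) = 1
      rw [hw1, hdσ 1, hd11]
    · show σ (w 0 : K) * (w 2 : K) = 1
      rw [hw0, hw2, hσu, mul_inv_cancel₀ hu0]
  have hwv : ∀ i, Valued.v (w i : K) = 1 := by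
    intro i
    fin_cases i
    · show Valued.v (w 0 : K) = 1
      rw [hw0, hu]
    · show Valued.v (w 1 : K) = 1
      rw [hw1, hd1v]
    · show Valued.v (w 2 : K) = 1
      rw [hw2, map_inv₀, hu, inv_one]
  obtain ⟨hwU, hwI⟩ := glDiagonal_mem_and_mem_glInt σ hJ w hwσ hwv
  -- `k₁ g k₂ = diag(w) · ϖ^{(-e)(1-i)}` in `GL₃(K)`
  have hkgk : k₁ * ((g : ↥(unitaryGroupOfForm σ J)) : GL (Fin 3) K) * k₂ = glDiagonal 3 K w * zpowDiagGL hϖ0 (fun i : Fin 3 => (-e) * (1 - (i.val : ℤ))) := by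
    refine Units.ext ?_
    rw [hdiag, Units.val_mul, coe_glDiagonal, coe_zpowDiagGL, Matrix.diagonal_mul_diagonal]
    congr 1
    funext i
    fin_cases i
    · show d 0 = (w 0 : K) * ϖ ^ ((-e) * (1 - ((0 : ℕ) : ℤ)))
      rw [hw0]
      simp only [Nat.cast_zero, sub_zero, mul_one, mul_assoc, ← zpow_add₀ hϖ0, add_neg_cancel, zpow_zero]
    · show d 1 = (w 1 : K) * ϖ ^ ((-e) * (1 - ((1 : ℕ) : ℤ)))
      rw [hw1]; simp
    · show d 2 = (w 2 : K) * ϖ ^ ((-e) * (1 - ((2 : ℕ) : ℤ)))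
      rw [hw2]
      have h2 : (-e) * (1 - ((2 : ℕ) : ℤ)) = e := by push_cast; ring
      rw [h2, mul_inv, inv_mul_cancel_right₀ (zpow_ne_zero e hϖ0)]
      exact (eq_inv_of_mul_eq_one_right hd02)
  -- as elements of `U`
  have hkgkU : (⟨k₁, hk₁U'⟩ : ↥(unitaryGroupOfForm σ J)) * g * ⟨k₂, hk₂U'⟩ =
      (⟨glDiagonal 3 K w, hwU⟩ : ↥(unitaryGroupOfForm σ J)) * ⟨zpowDiagGL hϖ0 (fun i : Fin 3 => (-e) * (1 - (i.val : ℤ))),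
        zpowDiagGL_mem_unitaryGroupOfForm_of_eq σ hϖ0 hd.σϖ hJ (fun i => by
          have hi := i.isLt; have hr : ((Fin.rev i).val : ℤ) = 2 - (i.val : ℤ) := by have h := Fin.val_rev i; omega
          rw [hr]; ring)⟩ := Subtype.ext hkgk
  have hg : g = (⟨k₁, hk₁U'⟩ : ↥(unitaryGroupOfForm σ J))⁻¹ * ((⟨glDiagonal 3 K w, hwU⟩ : ↥(unitaryGroupOfForm σ J)) *
      ⟨zpowDiagGL hϖ0 (fun i : Fin 3 => (-e) * (1 - (i.val : ℤ))), zpowDiagGL_mem_unitaryGroupOfForm_of_eq σ hϖ0 hd.σϖ hJ (fun i => by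
          have hi := i.isLt; have hr : ((Fin.rev i).val : ℤ) = 2 - (i.val : ℤ) := by have h := Fin.val_rev i; omega
          rw [hr]; ring)⟩) * (⟨k₂, hk₂U'⟩ : ↥(unitaryGroupOfForm σ J))⁻¹ := by
    rw [← hkgkU]; group
  rcases le_or_gt e 0 with he0 | he0
  · -- `-e ≥ 0`: the torus factor is `a (-e).toNat`
    have hM : zpowDiagGL hϖ0 (fun i : Fin 3 => (-e) * (1 - (i.val : ℤ))) = ((a (-e).toNat : ↥(unitaryGroupOfForm σ J)) : GL (Fin 3) K) := by
      rw [ha]; congr 1; funext i; rw [Int.toNat_of_nonneg (by omega)]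
    refine ⟨(⟨k₁, hk₁U'⟩ : ↥(unitaryGroupOfForm σ J))⁻¹ * ⟨glDiagonal 3 K w, hwU⟩, ?_, (⟨k₂, hk₂U'⟩ : ↥(unitaryGroupOfForm σ J))⁻¹, ?_, (-e).toNat, ?_⟩
    · exact Subgroup.mul_mem _ (Subgroup.inv_mem _ hk₁I) hwI
    · exact Subgroup.inv_mem _ hk₂I
    · have haeq : (⟨zpowDiagGL hϖ0 (fun i : Fin 3 => (-e) * (1 - (i.val : ℤ))), zpowDiagGL_mem_unitaryGroupOfForm_of_eq σ hϖ0 hd.σϖ hJ (fun i => by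
          have hi := i.isLt; have hr : ((Fin.rev i).val : ℤ) = 2 - (i.val : ℤ) := by have h := Fin.val_rev i; omega
          rw [hr]; ring)⟩ : ↥(unitaryGroupOfForm σ J)) = a (-e).toNat := Subtype.ext hM
      rw [hg, haeq]; group
  · -- `e > 0`: the torus factor is `(a e.toNat)⁻¹ = w₀ (a e.toNat) w₀`
    have hM : zpowDiagGL hϖ0 (fun i : Fin 3 => (-e) * (1 - (i.val : ℤ))) = (((a e.toNat)⁻¹ : ↥(unitaryGroupOfForm σ J)) : GL (Fin 3) K) := by
      rw [Subgroup.coe_inv, ha, ← zpowDiagGL_neg]; congr 1; funext i; simp only [Pi.neg_apply]; rw [Int.toNat_of_nonneg he0.le]; ring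
    refine ⟨(⟨k₁, hk₁U'⟩ : ↥(unitaryGroupOfForm σ J))⁻¹ * ⟨glDiagonal 3 K w, hwU⟩ * weylLongU σ hJ, ?_, weylLongU σ hJ * (⟨k₂, hk₂U'⟩ : ↥(unitaryGroupOfForm σ J))⁻¹, ?_, e.toNat, ?_⟩
    · exact Subgroup.mul_mem _ (Subgroup.mul_mem _ (Subgroup.inv_mem _ hk₁I) hwI) (weylLongU_mem_comap_glInt σ hJ)
    · exact Subgroup.mul_mem _ (weylLongU_mem_comap_glInt σ hJ) (Subgroup.inv_mem _ hk₂I)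
    · have haeq : (⟨zpowDiagGL hϖ0 (fun i : Fin 3 => (-e) * (1 - (i.val : ℤ))), zpowDiagGL_mem_unitaryGroupOfForm_of_eq σ hϖ0 hd.σϖ hJ (fun i => by
          have hi := i.isLt; have hr : ((Fin.rev i).val : ℤ) = 2 - (i.val : ℤ) := by have h := Fin.val_rev i; omega
          rw [hr]; ring)⟩ : ↥(unitaryGroupOfForm σ J)) = (a e.toNat)⁻¹ := Subtype.ext hM
      rw [hg, haeq, ← weylLongU_mul_torus_mul_weylLongU σ hJ hϖ0 a ha e.toNat]; group

end CartanForm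

end UnitaryGroup

end Literature.NumberTheory.Automorphic
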